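import Literature.NumberTheory.EllipticCurves.RealLatticeCovolumeProofs
import Literature.NumberTheory.EllipticCurves.IsogenyComplexUniformizationProofs
import Literature.NumberTheory.EllipticCurves.ModularCurve
import HarnessLib

/-!
# Crux `ThetaLayerLambdaCongruenceAtTwo` (stmt-BirchSwinnertonDyer-20688, route ResidualThetaTransportAtTwo), line
# `birth` v9, stub (C3k), plan ITEM B5: RHOMBIC LATTICES — `Δ < 0 ⇒` the Néron lattice is rhombic, and rhombicity
# is invariant under real scaling and under passage to a sublattice of ODD index (width seat bsd-wall-rtt-p3-w3 g3;
# `--supports stmt-BirchSwinnertonDyer-20688 --as helper`; closes nothing)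

HONEST FRAMING. Elementary statements about conjugation-stable subgroups of `ℂ` and about Mathlib's `PeriodPair`
lattices, on top of the tree's PROVED dictionary «rectangular ⟺ `g₂³ − 27g₃² > 0`» (`RealLatticeCovolumeProofs`).
No definition, no named fact; nothing about modular forms; BSD is not proved by any of this.

WHAT. Call a conjugation-stable subgroup `A ≤ ℂ` RHOMBIC when some `z ∈ A` has `z + z̄ ∉ 2A` (for a real rank-`2`
lattice: `A = ℤω ⊕ ℤω̄`, equivalently complex conjugation is NOT the identity on `A/2A`; the alternative is the
RECTANGULAR `A = ℤΩ₀ ⊕ ℤ·iΩ₀'`, conjugation `≡ 1 mod 2A`). This file spells the predicate out (no `def`) and proves: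
* `rhombic_of_rhombic_of_odd_index`, `rhombic_of_rhombic_sub_of_odd_index`, `rhombic_iff_of_odd_index` (§1): for
  conjugation-stable `B ≤ A` with `m·A ⊆ B`, `m` ODD, `A` is rhombic iff `B` is (Bezout `1 = m − 2k`);
* `rhombic_of_rhombic_real_mul`, `rhombic_iff_real_mul` (§1): invariance under `A ↦ c·A`, `c ∈ ℝ^×`;
* `PeriodPair.IsReal.exists_add_conj_notMem_two_mul_of_discr_neg` (§2): a real period lattice with
  `g₂³ − 27g₃² < 0` is rhombic — by the tree's `IsReal.discr_pos_of_half_sum_notMem` the half-sum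
  `z = (Ω₀ + iΩ₀')/2` lies in `Λ`, and `z + z̄ = Ω₀ ∉ 2Λ` (`IsReal.minRealPeriod_div_two_notMem`); conversely
  (`…forall_exists_add_conj_eq_two_mul_of_discr_pos`) `g₂³ − 27g₃² > 0` gives a rectangular lattice;
* `WeierstrassCurve.neronLattice_rhombic_of_Δ_neg` (§3): for an elliptic curve `W/ℚ` with `Δ_W < 0`, every Néron
  lattice `L` of `W ⊗ ℂ` (`IsNeronLatticeOf (W.baseChange ℂ) L`: `g₂ = c₄/12`, `g₃ = c₆/216`, so that
  `g₂³ − 27g₃² = Δ_W`) is rhombic.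
Consumer: with `…StarEigenform.exists_periodFunctional_iotaConj_add_notMem_ideal_smul` (B5 spine), the remaining
B5 bridge is «`Λ_g` = real multiple of an odd-index sublattice chain from `Λ_W`» (sibling `…StarBridge`).

References: [CremonaAlgorithms1997] §2.10 (pp. 29–30: "the lattice is either rectangular … positive discriminant, or
… negative discriminant"); [Lawden1989] §6.15–6.16; [SilvermanAEC2009] VI.5.1, C.16.
-/

noncomputable section

-- justification: the `Summit.BirchSwinnertonDyer.BirchSwinnertonDyer.…` path repeats a component (route-file convention)
set_option linter.dupNamespace false

open scoped ComplexConjugate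

open Complex

namespace Summit.BirchSwinnertonDyer.BirchSwinnertonDyer.Theorems.ThetaLayerLambdaCongruenceAtTwo

/-! ## §1. Rhombicity of conjugation-stable subgroups of `ℂ`: odd index and real scaling -/

section OddIndex

/-- **Odd-index descent.** `B ≤ A ≤ ℂ`, `A` conjugation-stable, `m` odd: if `A` is rhombic (some `z ∈ A` has
`z + z̄ ∉ 2A`) then so is `B ∋ m·z` — from `m z + conj(m z) = 2w'` one gets `z + z̄ = 2(w' − k(z + z̄))`, `m = 2k + 1`.
[folklore] -/
theorem rhombic_of_rhombic_of_odd_index {A B : AddSubgroup ℂ} (hBA : B ≤ A) (hA : ∀ z ∈ A, conj z ∈ A) {m : ℕ}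
    (hm : Odd m) (hmA : ∀ a ∈ A, (m : ℂ) * a ∈ B) (h : ∃ z ∈ A, ∀ w ∈ A, z + conj z ≠ 2 * w) :
    ∃ z ∈ B, ∀ w ∈ B, z + conj z ≠ 2 * w := by
  obtain ⟨z, hz, hzw⟩ := h
  obtain ⟨k, rfl⟩ := hm
  refine ⟨((2 * k + 1 : ℕ) : ℂ) * z, hmA z hz, fun w' hw' e ↦ ?_⟩
  have hzz : z + conj z ∈ A := add_mem hz (hA z hz)
  refine hzw (w' - (k : ℂ) * (z + conj z)) (sub_mem (hBA hw') ?_) ?_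
  · rw [← Int.cast_natCast, ← zsmul_eq_mul]
    exact A.zsmul_mem hzz _
  · rw [map_mul, map_natCast] at e
    push_cast at e
    linear_combination e

/-- **Odd-index ascent.** `B ≤ A ≤ ℂ`, `B` conjugation-stable, `m·A ⊆ B` with `m` odd: if `B` is rhombic then so is
`A` — if `z ∈ B` had `z + z̄ = 2w` with `w ∈ A`, then `2w ∈ B` and `m w ∈ B` give `w = m w − k(2w) ∈ B`.
[folklore] -/
theorem rhombic_of_rhombic_sub_of_odd_index {A B : AddSubgroup ℂ} (hBA : B ≤ A) (hB : ∀ z ∈ B, conj z ∈ B) {m : ℕ}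
    (hm : Odd m) (hmA : ∀ a ∈ A, (m : ℂ) * a ∈ B) (h : ∃ z ∈ B, ∀ w ∈ B, z + conj z ≠ 2 * w) :
    ∃ z ∈ A, ∀ w ∈ A, z + conj z ≠ 2 * w := by
  obtain ⟨z, hz, hzw⟩ := h
  obtain ⟨k, rfl⟩ := hm
  refine ⟨z, hBA hz, fun w hw e ↦ hzw w ?_ e⟩
  have h2w : (2 : ℂ) * w ∈ B := e ▸ add_mem hz (hB z hz)
  have hmw : ((2 * k + 1 : ℕ) : ℂ) * w ∈ B := hmA w hw
  have hkw : (k : ℂ) * ((2 : ℂ) * w) ∈ B := by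
    rw [← Int.cast_natCast, ← zsmul_eq_mul]
    exact B.zsmul_mem h2w _
  have e' : w = ((2 * k + 1 : ℕ) : ℂ) * w - (k : ℂ) * ((2 : ℂ) * w) := by push_cast; ring
  rw [e']
  exact sub_mem hmw hkw

/-- **Rhombicity is invariant under passage to an odd-index conjugation-stable sublattice** (`B ≤ A`, `m·A ⊆ B`,
`m` odd, both conjugation-stable). [folklore] -/
theorem rhombic_iff_of_odd_index {A B : AddSubgroup ℂ} (hBA : B ≤ A) (hA : ∀ z ∈ A, conj z ∈ A)
    (hB : ∀ z ∈ B, conj z ∈ B) {m : ℕ} (hm : Odd m) (hmA : ∀ a ∈ A, (m : ℂ) * a ∈ B) :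
    (∃ z ∈ A, ∀ w ∈ A, z + conj z ≠ 2 * w) ↔ (∃ z ∈ B, ∀ w ∈ B, z + conj z ≠ 2 * w) :=
  ⟨rhombic_of_rhombic_of_odd_index hBA hA hm hmA, rhombic_of_rhombic_sub_of_odd_index hBA hB hm hmA⟩

/-- **Real scaling.** If `B = c·A` for a real `c ≠ 0` (membership level: `z ∈ B ↔ z = c·a`, `a ∈ A`) and `A` is
rhombic then `B` is. [folklore] -/
theorem rhombic_of_rhombic_real_mul {A B : AddSubgroup ℂ} {c : ℝ} (hc : c ≠ 0)
    (hB : ∀ z, z ∈ B ↔ ∃ a ∈ A, z = (c : ℂ) * a) (h : ∃ z ∈ A, ∀ w ∈ A, z + conj z ≠ 2 * w) :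
    ∃ z ∈ B, ∀ w ∈ B, z + conj z ≠ 2 * w := by
  obtain ⟨z, hz, hzw⟩ := h
  refine ⟨(c : ℂ) * z, (hB _).mpr ⟨z, hz, rfl⟩, fun w hw e ↦ ?_⟩
  obtain ⟨a, ha, rfl⟩ := (hB w).mp hw
  refine hzw a ha ?_
  have hc' : (c : ℂ) ≠ 0 := Complex.ofReal_ne_zero.mpr hc
  rw [map_mul, Complex.conj_ofReal] at e
  exact mul_left_cancel₀ hc' (by linear_combination e)

/-- **Rhombicity is invariant under real homotheties** `A ↦ c·A`, `c ∈ ℝ^×`. [folklore] -/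
theorem rhombic_iff_real_mul {A B : AddSubgroup ℂ} {c : ℝ} (hc : c ≠ 0)
    (hB : ∀ z, z ∈ B ↔ ∃ a ∈ A, z = (c : ℂ) * a) :
    (∃ z ∈ A, ∀ w ∈ A, z + conj z ≠ 2 * w) ↔ (∃ z ∈ B, ∀ w ∈ B, z + conj z ≠ 2 * w) := by
  refine ⟨rhombic_of_rhombic_real_mul hc hB, rhombic_of_rhombic_real_mul (c := c⁻¹) (inv_ne_zero hc) fun z ↦ ?_⟩
  have hc' : (c : ℂ) ≠ 0 := Complex.ofReal_ne_zero.mpr hc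
  constructor
  · intro hz
    exact ⟨(c : ℂ) * z, (hB _).mpr ⟨z, hz, rfl⟩, by rw [Complex.ofReal_inv, ← mul_assoc, inv_mul_cancel₀ hc', one_mul]⟩
  · rintro ⟨b, hb, rfl⟩
    obtain ⟨a, ha, rfl⟩ := (hB b).mp hb
    rwa [Complex.ofReal_inv, ← mul_assoc, inv_mul_cancel₀ hc', one_mul]

end OddIndex

/-! ## §2. Real period lattices: `g₂³ − 27g₃² < 0` ⇒ rhombic (and `> 0` ⇒ rectangular) -/

section PeriodPair

open PeriodPair

/-- **A real period lattice of negative discriminant is rhombic.** For `L.IsReal` with `g₂³ − 27g₃² < 0` there is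
`z ∈ Λ` with `z + z̄ ∉ 2Λ`: the half-sum `z = (Ω₀ + iΩ₀')/2` lies in `Λ` (else the tree's
`IsReal.discr_pos_of_half_sum_notMem` would give `g₂³ − 27g₃² > 0`), and `z + z̄ = Ω₀` while `Ω₀/2 ∉ Λ`
(`IsReal.minRealPeriod_div_two_notMem`). Cremona 1997 §2.10 p. 30: in the non-rectangular case "the elliptic curve
has negative discriminant". [cite: CremonaAlgorithms1997, §2.10 (pp. 29–30)] -/
theorem _root_.PeriodPair.IsReal.exists_add_conj_notMem_two_mul_of_discr_neg {L : PeriodPair} (h : L.IsReal)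
    (hdisc : L.g₂.re ^ 3 - 27 * L.g₃.re ^ 2 < 0) :
    ∃ z ∈ L.lattice, ∀ w ∈ L.lattice, z + conj z ≠ 2 * w := by
  have hmem : ((L.minRealPeriod : ℂ) + I * (L.mulLeft I I_ne_zero).minRealPeriod) / 2 ∈ L.lattice := by
    by_contra hcase
    exact absurd (h.discr_pos_of_half_sum_notMem hdisc.ne hcase) (not_lt.mpr hdisc.le)
  refine ⟨_, hmem, fun w hw e ↦ h.minRealPeriod_div_two_notMem ?_⟩
  have e' : (L.minRealPeriod : ℂ) / 2 = w := by
    have : ((L.minRealPeriod : ℂ) + I * (L.mulLeft I I_ne_zero).minRealPeriod) / 2 +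
        conj (((L.minRealPeriod : ℂ) + I * (L.mulLeft I I_ne_zero).minRealPeriod) / 2) = L.minRealPeriod := by
      simp only [map_div₀, map_add, map_mul, Complex.conj_ofReal, Complex.conj_I, map_ofNat]
      ring
    rw [this] at e
    linear_combination e / 2
  rw [e']
  exact hw

/-- **A real period lattice of positive discriminant is rectangular**: every `z ∈ Λ` has `z + z̄ ∈ 2Λ`. From the
tree's explicit basis (`IsReal.exists_eq_lattice`): when the half-sum is not in `Λ`
(`IsReal.half_sum_notMem_of_discr_pos`), `Λ = ℤΩ₀ ⊕ ℤ·iΩ₀'` and `z + z̄ = 2mΩ₀`. Cremona 1997 §2.10 p. 30: "In this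
case the period lattice is rectangular … and the elliptic curve has positive discriminant."
[cite: CremonaAlgorithms1997, §2.10 (pp. 29–30)] -/
theorem _root_.PeriodPair.IsReal.forall_exists_add_conj_eq_two_mul_of_discr_pos {L : PeriodPair} (h : L.IsReal)
    (hdisc : 0 < L.g₂.re ^ 3 - 27 * L.g₃.re ^ 2) :
    ∀ z ∈ L.lattice, ∃ w ∈ L.lattice, z + conj z = 2 * w := by
  have hnot := h.half_sum_notMem_of_discr_pos hdisc
  obtain ⟨L₀, hL₀, hω₁, hω₂⟩ := h.exists_eq_lattice
  rw [if_neg hnot] at hω₂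
  intro z hz
  rw [← hL₀, PeriodPair.mem_lattice] at hz
  obtain ⟨m, n, rfl⟩ := hz
  refine ⟨m * L₀.ω₁, ?_, ?_⟩
  · rw [← hL₀, ← zsmul_eq_mul]
    exact L₀.lattice.smul_mem m L₀.ω₁_mem_lattice
  · rw [hω₁, hω₂]
    simp only [map_add, map_mul, map_intCast, Complex.conj_ofReal, Complex.conj_I]
    ring

end PeriodPair

/-! ## §3. Elliptic curves over `ℚ`: `Δ < 0` ⇒ every Néron lattice is rhombic -/

section Weierstrass

open Literature.NumberTheory.EllipticCurves Literature.NumberTheory.EllipticCurves.ModularForms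

/-- The discriminant of a Néron lattice of `W ⊗ ℂ` (`g₂ = c₄/12`, `g₃ = c₆/216`) for `W/ℚ` is `Δ_W`:
`g₂³ − 27g₃² = Δ` (Silverman AEC III.1: `1728Δ = c₄³ − c₆²`). [cite: SilvermanAEC2009, III.1] -/
theorem _root_.WeierstrassCurve.neronLattice_discr_eq_Δ (W : WeierstrassCurve ℚ) {L : PeriodPair}
    (hL : IsNeronLatticeOf (W.baseChange ℂ) L) : L.g₂.re ^ 3 - 27 * L.g₃.re ^ 2 = (W.Δ : ℝ) := by
  have h₂ : L.g₂ = (((W.baseChange ℝ).c₄ / 12 : ℝ) : ℂ) := by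
    rw [hL.1, WeierstrassCurve.baseChange, WeierstrassCurve.map_c₄, WeierstrassCurve.baseChange,
      WeierstrassCurve.map_c₄, ← ofReal_algebraMap_eq]
    push_cast
    ring
  have h₃ : L.g₃ = (((W.baseChange ℝ).c₆ / 216 : ℝ) : ℂ) := by
    rw [hL.2, WeierstrassCurve.baseChange, WeierstrassCurve.map_c₆, WeierstrassCurve.baseChange,
      WeierstrassCurve.map_c₆, ← ofReal_algebraMap_eq]
    push_cast
    ring
  have hΔ : (W.baseChange ℝ).Δ = (W.Δ : ℝ) := by
    rw [WeierstrassCurve.baseChange, WeierstrassCurve.map_Δ]; rfl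
  rw [h₂, h₃, Complex.ofReal_re, Complex.ofReal_re, ← hΔ]
  linear_combination -(W.baseChange ℝ).c_relation / 1728

/-- **`Δ_W < 0` ⇒ the Néron lattice is rhombic.** For an elliptic curve `W/ℚ` with negative discriminant and any
period pair `L` with `g₂(L) = c₄(W)/12`, `g₃(L) = c₆(W)/216` (`IsNeronLatticeOf (W.baseChange ℂ) L`), some `z ∈ Λ`
has `z + z̄ ∉ 2Λ` — complex conjugation is not the identity on `Λ/2Λ`, equivalently `W(ℝ)` is connected
(Cremona 1997 §2.10; the tree's `numRealComponents_of_Δ_nonpos`). [cite: CremonaAlgorithms1997, §2.10 (pp. 29–30)] -/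
theorem _root_.WeierstrassCurve.neronLattice_rhombic_of_Δ_neg (W : WeierstrassCurve ℚ) (hΔ : W.Δ < 0)
    {L : PeriodPair} (hL : IsNeronLatticeOf (W.baseChange ℂ) L) :
    ∃ z ∈ L.lattice, ∀ w ∈ L.lattice, z + conj z ≠ 2 * w := by
  have hreal : L.IsReal := WeierstrassCurve.isReal_of_g₂_g₃_eq (K := ℚ) hL.1 hL.2
  refine hreal.exists_add_conj_notMem_two_mul_of_discr_neg ?_
  rw [W.neronLattice_discr_eq_Δ hL]
  exact_mod_cast hΔ

/-- **`Δ_W > 0` ⇒ the Néron lattice is rectangular**: every `z ∈ Λ` has `z + z̄ ∈ 2Λ` (complex conjugation is the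
identity on `Λ/2Λ`; `W(ℝ)` has two components). [cite: CremonaAlgorithms1997, §2.10 (pp. 29–30)] -/
theorem _root_.WeierstrassCurve.neronLattice_rectangular_of_Δ_pos (W : WeierstrassCurve ℚ) (hΔ : 0 < W.Δ)
    {L : PeriodPair} (hL : IsNeronLatticeOf (W.baseChange ℂ) L) :
    ∀ z ∈ L.lattice, ∃ w ∈ L.lattice, z + conj z = 2 * w := by
  have hreal : L.IsReal := WeierstrassCurve.isReal_of_g₂_g₃_eq (K := ℚ) hL.1 hL.2
  refine hreal.forall_exists_add_conj_eq_two_mul_of_discr_pos ?_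
  rw [W.neronLattice_discr_eq_Δ hL]
  exact_mod_cast hΔ

end Weierstrass

end Summit.BirchSwinnertonDyer.BirchSwinnertonDyer.Theorems.ThetaLayerLambdaCongruenceAtTwo

end
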